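import Summits.QuantumFields.YangMills.Theorems.ContinuumLimitOnTrajectory.Negative.PinnedSector
import Summits.QuantumFields.YangMills.Theorems.ContinuumLimitOnTrajectory.Negative.ThreePoint
import Summits.QuantumFields.YangMills.Theorems.ContinuumLimitOnTrajectory.Negative.Interleaving

/-!
# `ContinuumLimitOnTrajectory` — negative-side support VIII: renormalisation-free necessary conditions
# of (A); the `0 < Δ` content switch

Support file for crux `stmt-QuantumFields-10522` ((A) of `ParabolicTrajectory`), extracted from §5–§7 of the
standing disprover's work file `Cruxes/ContinuumLimitOnTrajectory/Disproof.lean` (cdisprove gen 3). The crux decl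
`ContinuumLimitOnTrajectory` appears only as a HYPOTHESIS: these are consequences of (A), stated on Wilson lattice
expectations alone, whose failure along an admissible sequence would refute it.

* `continuumLimitOnTrajectory_imp_commonWitness`: (A) forces ONE OS datum for two equally-tuned sequences.
* `continuumLimitOnTrajectory_imp_kernelRatio` (I): kernel ratios `K_k(u,v)/K_k(u₀,v₀)` converge.
* `continuumLimitOnTrajectory_imp_universalRatio` (II): equally-tuned sequences have the same ratio limits —
  universality of the SHAPE of the curvature two-point kernel (independence of the torus growth `L_k` and of
  the fine structure of `β_k`).
* `continuumLimitOnTrajectory_imp_isotropicRatio` (III): rotated ratios have the same limit (the E1 burden).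
* `continuumLimitOnTrajectory_imp_skewnessRatio` (IV): normalised skewnesses `K3_k²/K_k³` converge (a
  Gaussian/trivial scaling limit of `tr F²` kills the `IsNonGaussian` clause).
* `abs_latticeConnectedCorr_le`, `hasLatticeMassGap_of_nonpos`: for `Δ ≤ 0` the gap clause holds along EVERY
  scheme — `0 < Δ` is the content switch of the gap hypothesis.
-/

namespace Summit.QuantumFields.YangMills.Theorems.ContinuumLimitOnTrajectory.Negative

open MeasureTheory Filter Topology Complex
open scoped SchwartzMap
open Literature.MathematicalPhysics.QuantumFieldTheory Literature.MathematicalPhysics.QuantumLattice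
open Literature.MathematicalPhysics.AQFT (IsOffDiagonal)
open Summit.QuantumFields.YangMills.Theses.ParabolicTrajectory (ContinuumLimitOnTrajectory)

noncomputable section

section CruxLevel

/-- **(A) forces a COMMON continuum limit for equally-tuned sequences** (universality content of the
`∀`-over-sequences quantifier, via interleaving): two schemes in the hypothesis block with the same
`(G, r, M, θ, Δ)` and equal towers `(lim N_t)_t` admit renormalisations along which ONE OS datum (non-trivial,
non-Gaussian in `tr F²`) is Yang–Mills for both. [folklore] -/
theorem continuumLimitOnTrajectory_imp_commonWitness (h : ContinuumLimitOnTrajectory) :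
    ∀ (G : Type) [Group G] [TopologicalSpace G] [IsTopologicalGroup G] [CompactSpace G],
      IsCompactSimpleLieGroup G →
        letI : MeasurableSpace G := borel G
        haveI : BorelSpace G := ⟨rfl⟩
        ∀ r : LatticeRep G, ∃ M₀ : ℕ, ∀ M : ℕ, M₀ ≤ M → 2 ≤ M → ∃ θ₀ : ℝ, 0 < θ₀ ∧
          ∀ (θ Δ : ℝ) (s₁ s₂ : SpeciesScheme (YMSpecies G)) (n₁ n₂ : ℕ → ℕ), 0 < θ → θ < θ₀ → 0 < Δ →
          (∀ k, s₁.a k = ((M : ℝ) ^ n₁ k)⁻¹) → Tendsto s₁.β atTop atTop →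
          (∀ t : ℕ, 0 < t → ∃ c : ℝ, Tendsto (fun k => ((M : ℝ) ^ n₁ k) ^ 8 *
            latticeConnectedCorr r.ρ (s₁.β k) (s₁.side k) r.curvature.F r.curvature.F (t * M ^ n₁ k))
              atTop (𝓝 c)) →
          Tendsto (fun k => ((M : ℝ) ^ n₁ k) ^ 8 *
            latticeConnectedCorr r.ρ (s₁.β k) (s₁.side k) r.curvature.F r.curvature.F (M ^ n₁ k))
              atTop (𝓝 θ) →
          HasLatticeMassGap r s₁ Δ →
          (∀ k, s₂.a k = ((M : ℝ) ^ n₂ k)⁻¹) → Tendsto s₂.β atTop atTop →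
          (∀ t : ℕ, 0 < t → ∃ c : ℝ, Tendsto (fun k => ((M : ℝ) ^ n₂ k) ^ 8 *
            latticeConnectedCorr r.ρ (s₂.β k) (s₂.side k) r.curvature.F r.curvature.F (t * M ^ n₂ k))
              atTop (𝓝 c)) →
          Tendsto (fun k => ((M : ℝ) ^ n₂ k) ^ 8 *
            latticeConnectedCorr r.ρ (s₂.β k) (s₂.side k) r.curvature.F r.curvature.F (M ^ n₂ k))
              atTop (𝓝 θ) →
          HasLatticeMassGap r s₂ Δ →
          (∀ t : ℕ, 0 < t → ∃ c : ℝ,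
            Tendsto (fun j => ((M : ℝ) ^ n₁ j) ^ 8 * latticeConnectedCorr r.ρ (s₁.β j) (s₁.side j)
              r.curvature.F r.curvature.F (t * M ^ n₁ j)) atTop (𝓝 c) ∧
            Tendsto (fun j => ((M : ℝ) ^ n₂ j) ^ 8 * latticeConnectedCorr r.ρ (s₂.β j) (s₂.side j)
              r.curvature.F r.curvature.F (t * M ^ n₂ j)) atTop (𝓝 c)) →
          ∃ T : OSData (YMSpecies G) 4,
            (∃ t₁ : SpeciesScheme (YMSpecies G), t₁.a = s₁.a ∧ t₁.β = s₁.β ∧ t₁.L = s₁.L ∧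
              IsYangMillsFor r t₁ T) ∧
            (∃ t₂ : SpeciesScheme (YMSpecies G), t₂.a = s₂.a ∧ t₂.β = s₂.β ∧ t₂.L = s₂.L ∧
              IsYangMillsFor r t₂ T) ∧
            T.IsNontrivial r.curvature ∧ T.IsNonGaussian r.curvature := by
  intro G _ _ _ _ hG r
  letI : MeasurableSpace G := borel G
  haveI : BorelSpace G := ⟨rfl⟩
  obtain ⟨M₀, hM₀⟩ := h G hG r
  refine ⟨M₀, fun M hM h2 => ?_⟩
  obtain ⟨θ₀, hθ₀, hθ⟩ := hM₀ M hM h2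
  refine ⟨θ₀, hθ₀, fun θ Δ s₁ s₂ n₁ n₂ h0 h1 hΔ a₁ b₁ c₁ d₁ e₁ a₂ b₂ c₂ d₂ e₂ htower => ?_⟩
  refine witness_split_of_interleave r (hθ θ Δ (interleave s₁ s₂) (interleaveFun n₁ n₂) h0 h1 hΔ
    (interleave_shape a₁ a₂) (tendsto_interleaveFun b₁ b₂) (fun t ht => ?_) ?_
    (hasLatticeMassGap_interleave r e₁ e₂))
  · obtain ⟨c, hc₁, hc₂⟩ := htower t ht
    exact ⟨c, tendsto_N_interleave r M (fun m => t * M ^ m) hc₁ hc₂⟩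
  · exact tendsto_N_interleave r M (fun m => M ^ m) d₁ d₂

/-- **Witness-free necessary condition I (one sequence): kernel ratios converge.** Along every sequence in the
hypothesis block (in the crux's window) there is a real time-separated pair `(u₀, v₀)` whose unit-normalised
lattice kernel is eventually nonzero and such that for EVERY off-diagonal real pair `(u, v)` the ratio
`K_k(u, v) / K_k(u₀, v₀)` of Wilson lattice expectations converges. [folklore] -/
theorem continuumLimitOnTrajectory_imp_kernelRatio (h : ContinuumLimitOnTrajectory) :
    ∀ (G : Type) [Group G] [TopologicalSpace G] [IsTopologicalGroup G] [CompactSpace G],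
      IsCompactSimpleLieGroup G →
        letI : MeasurableSpace G := borel G
        haveI : BorelSpace G := ⟨rfl⟩
        ∀ r : LatticeRep G, ∃ M₀ : ℕ, ∀ M : ℕ, M₀ ≤ M → 2 ≤ M → ∃ θ₀ : ℝ, 0 < θ₀ ∧
          ∀ (θ Δ : ℝ) (sch : SpeciesScheme (YMSpecies G)) (n : ℕ → ℕ), 0 < θ → θ < θ₀ → 0 < Δ →
          (∀ k, sch.a k = ((M : ℝ) ^ n k)⁻¹) → Tendsto sch.β atTop atTop →
          (∀ t : ℕ, 0 < t → ∃ c : ℝ, Tendsto (fun k => ((M : ℝ) ^ n k) ^ 8 *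
            latticeConnectedCorr r.ρ (sch.β k) (sch.side k) r.curvature.F r.curvature.F (t * M ^ n k))
              atTop (𝓝 c)) →
          Tendsto (fun k => ((M : ℝ) ^ n k) ^ 8 *
            latticeConnectedCorr r.ρ (sch.β k) (sch.side k) r.curvature.F r.curvature.F (M ^ n k))
              atTop (𝓝 θ) →
          HasLatticeMassGap r sch Δ →
          ∃ u₀ v₀ : 𝓢((EuclideanSpace ℝ (Fin 4)), ℝ), tsupport (u₀ : (EuclideanSpace ℝ (Fin 4)) → ℝ) ⊆ {z | z 0 < 0} ∧
            tsupport (v₀ : (EuclideanSpace ℝ (Fin 4)) → ℝ) ⊆ {z | 0 < z 0} ∧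
            (∀ᶠ k in atTop, twoPointKernel r.ρ (sch.a k) (sch.β k) (sch.L k) u₀ v₀ ≠ 0) ∧
            ∀ u v : 𝓢((EuclideanSpace ℝ (Fin 4)), ℝ), IsOffDiagonal (T2 u v) → ∃ ℓ : ℂ,
              Tendsto (fun k => ((twoPointKernel r.ρ (sch.a k) (sch.β k) (sch.L k) u v /
                twoPointKernel r.ρ (sch.a k) (sch.β k) (sch.L k) u₀ v₀ : ℝ) : ℂ)) atTop (𝓝 ℓ) := by
  intro G _ _ _ _ hG r
  letI : MeasurableSpace G := borel G
  haveI : BorelSpace G := ⟨rfl⟩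
  obtain ⟨M₀, hM₀⟩ := h G hG r
  refine ⟨M₀, fun M hM h2 => ?_⟩
  obtain ⟨θ₀, hθ₀, hθ⟩ := hM₀ M hM h2
  refine ⟨θ₀, hθ₀, fun θ Δ sch n h0 h1 hΔ a b c d e => ?_⟩
  obtain ⟨sch', ha, hβ, hL, T, hYM, hNT, -⟩ := hθ θ Δ sch n h0 h1 hΔ a b c d e
  obtain ⟨u₀, v₀, hu₀, hv₀, hne⟩ := exists_truncated_ne_zero_of_isNontrivial T r.curvature hNT
  have h₀ : IsOffDiagonal (T2 u₀ v₀) := isOffDiagonal_T2 hu₀ hv₀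
  refine ⟨u₀, v₀, hu₀, hv₀, ?_, fun u v huv =>
    ⟨S2T T r.curvature u v / S2T T r.curvature u₀ v₀, ?_⟩⟩
  · have e' := eventually_c_ne_zero_and_kernel_ne_zero r sch' T hYM h₀ hne
    simp only [ha, hβ, hL] at e'
    exact e'.mono fun k hk => hk.2
  · have t := tendsto_kernel_ratio r sch' T hYM h₀ hne huv
    simp only [ha, hβ, hL] at t
    exact t

/-- **Witness-free necessary condition II (two sequences): universality of the kernel shape.** For two
equally-tuned sequences in the hypothesis block (same `(G, r, M, θ, Δ)`, equal towers) the kernel ratios of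
BOTH converge to the SAME limits. Two admissible sequences with different shape limits refute the crux.
[folklore] -/
theorem continuumLimitOnTrajectory_imp_universalRatio (h : ContinuumLimitOnTrajectory) :
    ∀ (G : Type) [Group G] [TopologicalSpace G] [IsTopologicalGroup G] [CompactSpace G],
      IsCompactSimpleLieGroup G →
        letI : MeasurableSpace G := borel G
        haveI : BorelSpace G := ⟨rfl⟩
        ∀ r : LatticeRep G, ∃ M₀ : ℕ, ∀ M : ℕ, M₀ ≤ M → 2 ≤ M → ∃ θ₀ : ℝ, 0 < θ₀ ∧
          ∀ (θ Δ : ℝ) (s₁ s₂ : SpeciesScheme (YMSpecies G)) (n₁ n₂ : ℕ → ℕ), 0 < θ → θ < θ₀ → 0 < Δ →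
          (∀ k, s₁.a k = ((M : ℝ) ^ n₁ k)⁻¹) → Tendsto s₁.β atTop atTop →
          (∀ t : ℕ, 0 < t → ∃ c : ℝ, Tendsto (fun k => ((M : ℝ) ^ n₁ k) ^ 8 *
            latticeConnectedCorr r.ρ (s₁.β k) (s₁.side k) r.curvature.F r.curvature.F (t * M ^ n₁ k))
              atTop (𝓝 c)) →
          Tendsto (fun k => ((M : ℝ) ^ n₁ k) ^ 8 *
            latticeConnectedCorr r.ρ (s₁.β k) (s₁.side k) r.curvature.F r.curvature.F (M ^ n₁ k))
              atTop (𝓝 θ) →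
          HasLatticeMassGap r s₁ Δ →
          (∀ k, s₂.a k = ((M : ℝ) ^ n₂ k)⁻¹) → Tendsto s₂.β atTop atTop →
          (∀ t : ℕ, 0 < t → ∃ c : ℝ, Tendsto (fun k => ((M : ℝ) ^ n₂ k) ^ 8 *
            latticeConnectedCorr r.ρ (s₂.β k) (s₂.side k) r.curvature.F r.curvature.F (t * M ^ n₂ k))
              atTop (𝓝 c)) →
          Tendsto (fun k => ((M : ℝ) ^ n₂ k) ^ 8 *
            latticeConnectedCorr r.ρ (s₂.β k) (s₂.side k) r.curvature.F r.curvature.F (M ^ n₂ k))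
              atTop (𝓝 θ) →
          HasLatticeMassGap r s₂ Δ →
          (∀ t : ℕ, 0 < t → ∃ c : ℝ,
            Tendsto (fun j => ((M : ℝ) ^ n₁ j) ^ 8 * latticeConnectedCorr r.ρ (s₁.β j) (s₁.side j)
              r.curvature.F r.curvature.F (t * M ^ n₁ j)) atTop (𝓝 c) ∧
            Tendsto (fun j => ((M : ℝ) ^ n₂ j) ^ 8 * latticeConnectedCorr r.ρ (s₂.β j) (s₂.side j)
              r.curvature.F r.curvature.F (t * M ^ n₂ j)) atTop (𝓝 c)) →
          ∃ u₀ v₀ : 𝓢((EuclideanSpace ℝ (Fin 4)), ℝ), tsupport (u₀ : (EuclideanSpace ℝ (Fin 4)) → ℝ) ⊆ {z | z 0 < 0} ∧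
            tsupport (v₀ : (EuclideanSpace ℝ (Fin 4)) → ℝ) ⊆ {z | 0 < z 0} ∧
            ∀ u v : 𝓢((EuclideanSpace ℝ (Fin 4)), ℝ), IsOffDiagonal (T2 u v) → ∃ ℓ : ℂ,
              Tendsto (fun k => ((twoPointKernel r.ρ (s₁.a k) (s₁.β k) (s₁.L k) u v /
                twoPointKernel r.ρ (s₁.a k) (s₁.β k) (s₁.L k) u₀ v₀ : ℝ) : ℂ)) atTop (𝓝 ℓ) ∧
              Tendsto (fun k => ((twoPointKernel r.ρ (s₂.a k) (s₂.β k) (s₂.L k) u v /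
                twoPointKernel r.ρ (s₂.a k) (s₂.β k) (s₂.L k) u₀ v₀ : ℝ) : ℂ)) atTop (𝓝 ℓ) := by
  intro G _ _ _ _ hG r
  letI : MeasurableSpace G := borel G
  haveI : BorelSpace G := ⟨rfl⟩
  obtain ⟨M₀, hM₀⟩ := continuumLimitOnTrajectory_imp_commonWitness h G hG r
  refine ⟨M₀, fun M hM h2 => ?_⟩
  obtain ⟨θ₀, hθ₀, hθ⟩ := hM₀ M hM h2
  refine ⟨θ₀, hθ₀, fun θ Δ s₁ s₂ n₁ n₂ h0 h1 hΔ a₁ b₁ c₁ d₁ e₁ a₂ b₂ c₂ d₂ e₂ htower => ?_⟩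
  obtain ⟨T, ⟨t₁, ha₁, hβ₁, hL₁, hY₁⟩, ⟨t₂, ha₂, hβ₂, hL₂, hY₂⟩, hNT, -⟩ :=
    hθ θ Δ s₁ s₂ n₁ n₂ h0 h1 hΔ a₁ b₁ c₁ d₁ e₁ a₂ b₂ c₂ d₂ e₂ htower
  obtain ⟨u₀, v₀, hu₀, hv₀, hne⟩ := exists_truncated_ne_zero_of_isNontrivial T r.curvature hNT
  have h₀ : IsOffDiagonal (T2 u₀ v₀) := isOffDiagonal_T2 hu₀ hv₀
  refine ⟨u₀, v₀, hu₀, hv₀, fun u v huv =>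
    ⟨S2T T r.curvature u v / S2T T r.curvature u₀ v₀, ?_, ?_⟩⟩
  · have t := tendsto_kernel_ratio r t₁ T hY₁ h₀ hne huv
    simp only [ha₁, hβ₁, hL₁] at t
    exact t
  · have t := tendsto_kernel_ratio r t₂ T hY₂ h₀ hne huv
    simp only [ha₂, hβ₂, hL₂] at t
    exact t

/-- **Witness-free necessary condition III: rotational symmetry of the kernel shape.** Along every sequence in
the hypothesis block there is a real time-separated `(u₀, v₀)` such that for every off-diagonal real `(u, v)` and
every proper rotation `L ∈ SO(4)` the ratios `K_k(u∘L⁻¹, v∘L⁻¹)/K_k(u₀, v₀)` and `K_k(u, v)/K_k(u₀, v₀)` have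
the SAME limit: the hypercubic anisotropy of Wilson's lattice theory must die out in the kernel shape (the E1
burden of (A), on lattice expectations alone). [folklore] -/
theorem continuumLimitOnTrajectory_imp_isotropicRatio (h : ContinuumLimitOnTrajectory) :
    ∀ (G : Type) [Group G] [TopologicalSpace G] [IsTopologicalGroup G] [CompactSpace G],
      IsCompactSimpleLieGroup G →
        letI : MeasurableSpace G := borel G
        haveI : BorelSpace G := ⟨rfl⟩
        ∀ r : LatticeRep G, ∃ M₀ : ℕ, ∀ M : ℕ, M₀ ≤ M → 2 ≤ M → ∃ θ₀ : ℝ, 0 < θ₀ ∧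
          ∀ (θ Δ : ℝ) (sch : SpeciesScheme (YMSpecies G)) (n : ℕ → ℕ), 0 < θ → θ < θ₀ → 0 < Δ →
          (∀ k, sch.a k = ((M : ℝ) ^ n k)⁻¹) → Tendsto sch.β atTop atTop →
          (∀ t : ℕ, 0 < t → ∃ c : ℝ, Tendsto (fun k => ((M : ℝ) ^ n k) ^ 8 *
            latticeConnectedCorr r.ρ (sch.β k) (sch.side k) r.curvature.F r.curvature.F (t * M ^ n k))
              atTop (𝓝 c)) →
          Tendsto (fun k => ((M : ℝ) ^ n k) ^ 8 *
            latticeConnectedCorr r.ρ (sch.β k) (sch.side k) r.curvature.F r.curvature.F (M ^ n k))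
              atTop (𝓝 θ) →
          HasLatticeMassGap r sch Δ →
          ∃ u₀ v₀ : 𝓢((EuclideanSpace ℝ (Fin 4)), ℝ), tsupport (u₀ : (EuclideanSpace ℝ (Fin 4)) → ℝ) ⊆ {z | z 0 < 0} ∧
            tsupport (v₀ : (EuclideanSpace ℝ (Fin 4)) → ℝ) ⊆ {z | 0 < z 0} ∧
            ∀ u v : 𝓢((EuclideanSpace ℝ (Fin 4)), ℝ), IsOffDiagonal (T2 u v) → ∀ L : (EuclideanSpace ℝ (Fin 4)) ≃ₗᵢ[ℝ] (EuclideanSpace ℝ (Fin 4)),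
              LinearMap.det (L.toLinearEquiv : (EuclideanSpace ℝ (Fin 4)) →ₗ[ℝ] (EuclideanSpace ℝ (Fin 4))) = 1 → ∃ ℓ : ℂ,
              Tendsto (fun k => ((twoPointKernel r.ρ (sch.a k) (sch.β k) (sch.L k) u v /
                twoPointKernel r.ρ (sch.a k) (sch.β k) (sch.L k) u₀ v₀ : ℝ) : ℂ)) atTop (𝓝 ℓ) ∧
              Tendsto (fun k => ((twoPointKernel r.ρ (sch.a k) (sch.β k) (sch.L k)
                  (rotTest L u) (rotTest L v) /
                twoPointKernel r.ρ (sch.a k) (sch.β k) (sch.L k) u₀ v₀ : ℝ) : ℂ)) atTop (𝓝 ℓ) := by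
  intro G _ _ _ _ hG r
  letI : MeasurableSpace G := borel G
  haveI : BorelSpace G := ⟨rfl⟩
  obtain ⟨M₀, hM₀⟩ := h G hG r
  refine ⟨M₀, fun M hM h2 => ?_⟩
  obtain ⟨θ₀, hθ₀, hθ⟩ := hM₀ M hM h2
  refine ⟨θ₀, hθ₀, fun θ Δ sch n h0 h1 hΔ a b c d e => ?_⟩
  obtain ⟨sch', ha, hβ, hL, T, hYM, hNT, -⟩ := hθ θ Δ sch n h0 h1 hΔ a b c d e
  obtain ⟨u₀, v₀, hu₀, hv₀, hne⟩ := exists_truncated_ne_zero_of_isNontrivial T r.curvature hNT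
  have h₀ : IsOffDiagonal (T2 u₀ v₀) := isOffDiagonal_T2 hu₀ hv₀
  refine ⟨u₀, v₀, hu₀, hv₀, fun u v huv L hdet =>
    ⟨S2T T r.curvature u v / S2T T r.curvature u₀ v₀, ?_, ?_⟩⟩
  · have t := tendsto_kernel_ratio r sch' T hYM h₀ hne huv
    simp only [ha, hβ, hL] at t
    exact t
  · have t := tendsto_kernel_ratio_rotTest r sch' T hYM h₀ hne huv L hdet
    simp only [ha, hβ, hL] at t
    exact t

/-- **Witness-free necessary condition IV: asymptotic skewness has a limit.** Along every sequence in the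
hypothesis block there is a real time-separated `(u₀, v₀)` such that for every pairwise disjointly supported
real triple `(f, g, h)` the normalised lattice skewness `K3_k(f,g,h)²/K_k(u₀,v₀)³` of the curvature field
converges. (`IsNonGaussian` demands in addition a nonzero `κ₃` of the witness on some admissible complex triple:
a GAUSSIAN scaling limit of `tr F²` — the triviality scenario of `φ⁴₄` — refutes (A) once its hypotheses are
met.) [folklore] -/
theorem continuumLimitOnTrajectory_imp_skewnessRatio (h : ContinuumLimitOnTrajectory) :
    ∀ (G : Type) [Group G] [TopologicalSpace G] [IsTopologicalGroup G] [CompactSpace G],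
      IsCompactSimpleLieGroup G →
        letI : MeasurableSpace G := borel G
        haveI : BorelSpace G := ⟨rfl⟩
        ∀ r : LatticeRep G, ∃ M₀ : ℕ, ∀ M : ℕ, M₀ ≤ M → 2 ≤ M → ∃ θ₀ : ℝ, 0 < θ₀ ∧
          ∀ (θ Δ : ℝ) (sch : SpeciesScheme (YMSpecies G)) (n : ℕ → ℕ), 0 < θ → θ < θ₀ → 0 < Δ →
          (∀ k, sch.a k = ((M : ℝ) ^ n k)⁻¹) → Tendsto sch.β atTop atTop →
          (∀ t : ℕ, 0 < t → ∃ c : ℝ, Tendsto (fun k => ((M : ℝ) ^ n k) ^ 8 *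
            latticeConnectedCorr r.ρ (sch.β k) (sch.side k) r.curvature.F r.curvature.F (t * M ^ n k))
              atTop (𝓝 c)) →
          Tendsto (fun k => ((M : ℝ) ^ n k) ^ 8 *
            latticeConnectedCorr r.ρ (sch.β k) (sch.side k) r.curvature.F r.curvature.F (M ^ n k))
              atTop (𝓝 θ) →
          HasLatticeMassGap r sch Δ →
          ∃ u₀ v₀ : 𝓢((EuclideanSpace ℝ (Fin 4)), ℝ), tsupport (u₀ : (EuclideanSpace ℝ (Fin 4)) → ℝ) ⊆ {z | z 0 < 0} ∧
            tsupport (v₀ : (EuclideanSpace ℝ (Fin 4)) → ℝ) ⊆ {z | 0 < z 0} ∧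
            ∀ f g g' : 𝓢((EuclideanSpace ℝ (Fin 4)), ℝ), PairwiseDisjoint3 f g g' → ∃ ℓ : ℂ,
              Tendsto (fun k => (((threePointKernel r.ρ (sch.a k) (sch.β k) (sch.L k) f g g') ^ 2 /
                (twoPointKernel r.ρ (sch.a k) (sch.β k) (sch.L k) u₀ v₀) ^ 3 : ℝ) : ℂ)) atTop (𝓝 ℓ) := by
  intro G _ _ _ _ hG r
  letI : MeasurableSpace G := borel G
  haveI : BorelSpace G := ⟨rfl⟩
  obtain ⟨M₀, hM₀⟩ := h G hG r
  refine ⟨M₀, fun M hM h2 => ?_⟩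
  obtain ⟨θ₀, hθ₀, hθ⟩ := hM₀ M hM h2
  refine ⟨θ₀, hθ₀, fun θ Δ sch n h0 h1 hΔ a b c d e => ?_⟩
  obtain ⟨sch', ha, hβ, hL, T, hYM, hNT, -⟩ := hθ θ Δ sch n h0 h1 hΔ a b c d e
  obtain ⟨u₀, v₀, hu₀, hv₀, hne⟩ := exists_truncated_ne_zero_of_isNontrivial T r.curvature hNT
  have hoff : IsOffDiagonal (T2 u₀ v₀) := isOffDiagonal_T2 hu₀ hv₀
  refine ⟨u₀, v₀, hu₀, hv₀, fun f g g' hp =>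
    ⟨(S3T T r.curvature f g g') ^ 2 / (S2T T r.curvature u₀ v₀) ^ 3, ?_⟩⟩
  have t := tendsto_skewness_ratio r sch' T hYM hoff hne hp
  simp only [ha, hβ, hL] at t
  exact t

end CruxLevel

section Decorations

variable {G : Type} [Group G] [TopologicalSpace G] [IsTopologicalGroup G] [CompactSpace G]
  [MeasurableSpace G] [BorelSpace G]

/-- Connected torus correlations of bounded observables are bounded by `2 C_A C_B` at EVERY coupling
(Wilson's measure is a probability measure). [folklore] -/
theorem abs_latticeConnectedCorr_le (r : LatticeRep G) (β : ℝ) (S : ℕ) [NeZero S]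
    {A B : LGConfig 4 G → ℝ} {CA CB : ℝ} (hA : ∀ U, |A U| ≤ CA) (hB : ∀ U, |B U| ≤ CB) (m : ℕ) :
    |latticeConnectedCorr r.ρ β S A B m| ≤ 2 * CA * CB := by
  haveI := isProbabilityMeasure_wilsonMeasure (d := 4) (L := S) r.ρ r.continuous β
  have hCA0 : 0 ≤ CA := (abs_nonneg _).trans (hA fun _ => 1)
  unfold latticeConnectedCorr
  refine (abs_sub _ _).trans ?_
  have h1 : |∫ U, A (torusLift S U) * B (configShift (-Pi.single 0 (m : ℤ)) (torusLift S U))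
      ∂wilsonMeasure (d := 4) (L := S) r.ρ β| ≤ CA * CB :=
    abs_integral_le _ fun U => by
      rw [abs_mul]; exact mul_le_mul (hA _) (hB _) (abs_nonneg _) hCA0
  have h2 : |(∫ U, A (torusLift S U) ∂wilsonMeasure (d := 4) (L := S) r.ρ β) *
      ∫ U, B (torusLift S U) ∂wilsonMeasure (d := 4) (L := S) r.ρ β| ≤ CA * CB := by
    rw [abs_mul]
    exact mul_le_mul (abs_integral_le _ fun U => hA _) (abs_integral_le _ fun U => hB _)
      (abs_nonneg _) hCA0
  linarith

/-- **For `Δ ≤ 0` the uniform lattice gap holds along EVERY scheme** (`|corr| ≤ 2 C_A C_B ≤ 2 C_A C_B e^{-Δ a_k n}`):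
the clause `0 < Δ` is exactly what gives the gap hypothesis of (A) content; (A) with `0 < Δ` dropped is (A) with
the gap hypothesis deleted. [folklore] -/
theorem hasLatticeMassGap_of_nonpos (r : LatticeRep G) (sch : SpeciesScheme (YMSpecies G)) {Δ : ℝ}
    (hΔ : Δ ≤ 0) : HasLatticeMassGap r sch Δ := by
  intro A B
  obtain ⟨CA, hCA⟩ := A.bounded
  obtain ⟨CB, hCB⟩ := B.bounded
  refine ⟨2 * CA * CB, Eventually.of_forall fun k S _ m _ => ?_⟩
  have hle := abs_latticeConnectedCorr_le r (sch.β k) (2 * S + 1) hCA hCB m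
  have h0 : 0 ≤ 2 * CA * CB := (abs_nonneg _).trans hle
  have hexp : 1 ≤ Real.exp (-(Δ * (sch.a k * m))) := Real.one_le_exp
    (neg_nonneg.2 (mul_nonpos_of_nonpos_of_nonneg hΔ (by have := sch.a_pos k; positivity)))
  calc |latticeConnectedCorr r.ρ (sch.β k) (2 * S + 1) A.F B.F m| ≤ 2 * CA * CB * 1 := by
        rw [mul_one]; exact hle
    _ ≤ 2 * CA * CB * Real.exp (-(Δ * (sch.a k * m))) := mul_le_mul_of_nonneg_left hexp h0

end Decorations

end

end Summit.QuantumFields.YangMills.Theorems.ContinuumLimitOnTrajectory.Negative
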